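import Literature.Topology.FourManifolds.HomotopySpheresBPCyclic
import Literature.Topology.FourManifolds.HomotopySpheresBPOrder
import Literature.Topology.FourManifolds.HomotopySpheresBPOrderSignatureLeaves
import HarnessLib

/-!
# `bP₄ₘ` is cyclic from Kervaire–Milnor's Thm. 7.5 alone: `Θ₇` is cyclic without Lemma 7.4

Topic `Literature/Topology/FourManifolds`; sibling proofs file of `HomotopySpheresBP.lean`,
`HomotopySpheresBPProofs.lean` and `HomotopySpheresBPCyclic.lean`. Kervaire–Milnor, *Groups of
homotopy spheres I*, Ann. of Math. 77 (1963), Cor. 7.6, p. 530: "The group `bP₄ₘ`, `m > 1`, is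
isomorphic to a subgroup of the cyclic group of order `σₘ`. Hence `bP₄ₘ` is finite cyclic." The
first sentence uses only Thm. 7.5 (and the additivity of `σ` over connected sums, §2); Lemma 7.4
(`σₘ ≠ 0`: some s-parallelizable `M₀` bounded by `S⁴ᵐ⁻¹` has `σ(M₀) ≠ 0`, from Milnor–Kervaire's
almost parallelizable manifolds [18]) is needed only for the word "finite". Everything here is
**proved**; no definition and no named fact is introduced (D-0026).

## What this file adds

The tree proves Cor. 7.6 — the named fact
`Literature.Topology.FourManifolds.HomotopySphereClass.isCyclic_bP_four_mul`, "`bP₄ₘ` is the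
carrier of a finite cyclic subgroup" — and assembles the target
`Literature.Topology.FourManifolds.exists_commGroup_homotopySphereClass_isCyclic_seven` (`Θ₇` is a
cyclic group under connected sum) from it (`HCobordismProofs.lean`, `HomotopySpheresBPProofs.lean`,
`HomotopySpheresBPCyclic.lean`), always consuming Lemma 7.4 (the named fact
`Literature.Topology.FourManifolds.HomotopySphere.exists_mem_signatureSet_sphere_ne_zero`) —
although every one of these assemblies discards the finiteness clause of Cor. 7.6: the target only
asks for `IsCyclic (HomotopySphereClass 7)`. This file records that **cyclicity needs no
Lemma 7.4**:

* `HomotopySphereClass.isCyclic_of_coe_subset_bP` — in one dimension `n + 1 = 4m`, for one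
  `IsMul`-compatible commutative group structure on `Θₙ` and one generator convention `g`, every
  subgroup of `Θₙ` contained in `bPₙ₊₁` is cyclic, given in that dimension: Thm. 7.5
  (`[Σ₁] = [Σ₂] ↔ σₘ ∣ σ(M₁) - σ(M₂)`), §2-additivity of `σ`, the Lemma 3.4 comparison
  "bounds a parallelizable manifold ⇒ bounds an oriented s-parallelizable one", and existence of
  products. Proof (Kervaire–Milnor p. 530, first sentence): `[Σ] ↦ σ(M) mod σₘ` is a well-defined
  injective multiplicative map into `ℤ/σₘ` — **for every value of `σₘ`, including the junk value
  `σₘ = 0` of an (a priori) trivial signature group, where `ℤ/0 = ℤ`** — and a group embedding in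
  the cyclic group `ℤ/σₘ` (`ZMod.instIsAddCyclic`, all moduli) is cyclic.
* `HomotopySphereClass.exists_subgroup_coe_eq_bP_isCyclic_of_dim` — pointwise Cor. 7.6 without
  "finite": `bPₙ₊₁` is the carrier of a cyclic subgroup, for a compatible group structure whose
  unit is `[Sⁿ]` and whose inverse is `[Σ] ↦ [-Σ]` (as provided by Kervaire–Milnor's Thm. 1.1,
  `Literature.Topology.FourManifolds.exists_commGroup_homotopySphereClass`): `bPₙ₊₁` is then closed
  under products (§2-additivity with both Lemma 3.4 comparisons), contains the unit
  (`HomotopySphereClass.one_mem_bP`: `Sⁿ = b𝔻ⁿ⁺¹`) and is closed under inverses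
  (`HomotopySphereClass.neg_mem_bP_iff`: `-Σ = b(-W)`) — replacing the finiteness argument of
  `HomotopySphereClass.exists_subgroup_coe_eq_bP_of_dim`, which is where Lemma 7.4 entered;
  `HomotopySphereClass.exists_subgroup_coe_eq_bP_isCyclic_of_signatureFacts` — the same for all
  `m > 1` from the four named facts Thm. 7.5, §2-additivity and the two Lemma 3.4 comparisons.
* `exists_commGroup_homotopySphereClass_isCyclic_seven_of_dim_thm75` — the dimension-`7` assembly
  of the target from a compatible group structure on `Θ₇`, `Θ₇ = bP₈` (§4, table p. 512) and the
  three inputs Thm. 7.5, §2-additivity, Lemma 3.4 (⇒) at `n = 7`, `m = 2` (here `bP₈ = Θ₇` is all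
  of `Θ₇`, so no closure property of `bP₈` is needed at all);
  `exists_commGroup_homotopySphereClass_isCyclic_seven_of_thm75` — the same from the named facts
  Thm. 1.1, `HomotopySphere.boundsParallelizable_seven`, `mk_eq_mk_iff_sigmaGen_dvd_sub`,
  `add_mem_signatureSet_of_isOrientedConnectedSum`, `nonempty_signatureSet_of_boundsParallelizable`;
  `exists_commGroup_homotopySphereClass_isCyclic_seven_of_manifoldFacts_thm75` — the leaf-level
  assembly of `HomotopySpheresBPProofs.lean`
  (`exists_commGroup_homotopySphereClass_isCyclic_seven_of_manifoldFacts`, fifteen named facts)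
  with Lemma 7.4 and Lemma 3.4 (⇐) removed: thirteen named facts.

Consequently the named fact `HomotopySphere.exists_mem_signatureSet_sphere_ne_zero` (Lemma 7.4,
whose only known proofs go through the `J`-homomorphism, Bott periodicity, the finiteness of the
stable stems and the signature theorem) is not on the critical path of
`exists_commGroup_homotopySphereClass_isCyclic_seven`; it remains an input of the genuinely
finite statements (`isCyclic_bP_four_mul` with its `Finite` clause, all `m > 1`), while the order
`|bP₈| = 28` (`HomotopySpheresBPOrderProofs.lean`) uses `σ₂ = 224` instead. In dimension `7` even
the finite form needs no separate Lemma 7.4: its instance `n = 7`, `m = 2` is implied by the named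
fact `HomotopySphere.exists_twoHundredTwentyFour_mem_signatureSet_sphere` (`224` is such a
signature, and `224 ≠ 0`) that the order computation consumes anyway —
`HomotopySphere.exists_mem_signatureSet_sphere_ne_zero_seven_of_twoHundredTwentyFour`, whence
`HomotopySphereClass.exists_subgroup_coe_eq_bP_seven_of_twoHundredTwentyFour` (`bP₈` is the
carrier of a finite cyclic subgroup, from `σ₂`-existence, Thm. 7.5, §2 and Lemma 3.4).

## References

* M. Kervaire, J. Milnor, *Groups of homotopy spheres I*, Ann. of Math. 77 (1963), 504–537: §2
  (p. 505–508), Lemma 3.4 (p. 509), §4 (p. 512: `bPₙ₊₁` is a subgroup; table), §7: definition of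
  `σₘ` (p. 529), Thm. 7.5 (pp. 529–530), Cor. 7.6 (p. 530, first sentence of the statement).
  [KervaireMilnorAnnals1963]
* A. Kosinski, *Differential Manifolds* (1993), Ch. X §6, (6.6) and Prop. 6.2(a). [Kosinski1993]
-/

open scoped Manifold ContDiff Topology
open Set Function

noncomputable section

namespace Literature.Topology.FourManifolds

namespace HomotopySphereClass

open HomotopySphere

variable {n : ℕ}

/-- **Subgroups of `Θₙ` inside `bPₙ₊₁` are cyclic, from Thm. 7.5 (no Lemma 7.4).** Let
`n + 1 = 4m`, fix a commutative group structure on `Θₙ = HomotopySphereClass n` whose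
multiplication is the connected sum (`IsMul a b c → a * b = c`) and a generator convention `g` for
`Hₙ(ℝⁿ | pt; ℤ)`, and assume, in this dimension and for this `g`: (Thm. 7.5) for homotopy spheres
`Σ₁`, `Σ₂` bounding oriented s-parallelizable `M₁`, `M₂`, `[Σ₁] = [Σ₂] ↔ σₘ ∣ σ(M₁) - σ(M₂)`;
(§2) signatures add over oriented connected sums; (Lemma 3.4, ⇒) a homotopy sphere bounding a
parallelizable manifold bounds an oriented s-parallelizable one; and products exist in `Θₙ`. Then
every subgroup `H` of `Θₙ` with `H ⊆ bPₙ₊₁` is cyclic: `[Σ] ↦ σ(M) mod σₘ` is a well-defined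
(Thm. 7.5, ⇒) injective (Thm. 7.5, ⇐) group homomorphism `H → ℤ/σₘ` (§2), and `ℤ/σₘ` is cyclic for
every `σₘ : ℕ` — for `σₘ = 0` it is `ℤ` — so that Lemma 7.4 (`σₘ ≠ 0`) is not used. Kervaire–Milnor
1963, Cor. 7.6, p. 530: "The group `bP₄ₘ`, `m > 1`, is isomorphic to a subgroup of the cyclic group
of order `σₘ`." [cite: KervaireMilnorAnnals1963, Cor. 7.6 (p. 530, first sentence), from Thm. 7.5 and §2] -/
theorem isCyclic_of_coe_subset_bP {m : ℕ} (h : n + 1 = 4 * m)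
    [CommGroup (HomotopySphereClass n)]
    (hcompat : ∀ a b c : HomotopySphereClass n, IsMul a b c → a * b = c)
    (g : Literature.AlgebraicTopology.SingularHomology.HomologicalOrientation ℤ (EuclideanSpace ℝ (Fin n)) n)
    (h75 : ∀ (S T : HomotopySphere n) (σ τ : ℤ), σ ∈ signatureSet g m h S →
      τ ∈ signatureSet g m h T → (mk S = mk T ↔ (sigmaGen g m h : ℤ) ∣ σ - τ))
    (hadd : ∀ S T U : HomotopySphere n,
      IsOrientedConnectedSum S.orientation T.orientation U.orientation →
        ∀ σ ∈ signatureSet g m h S, ∀ τ ∈ signatureSet g m h T, σ + τ ∈ signatureSet g m h U)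
    (hne : ∀ S : HomotopySphere n, S.BoundsParallelizable → (signatureSet g m h S).Nonempty)
    (hmul : ∀ a b : HomotopySphereClass n, ∃ c, IsMul a b c)
    (H : Subgroup (HomotopySphereClass n)) (hH : (H : Set (HomotopySphereClass n)) ⊆ bP n) :
    IsCyclic H := by
  classical
  -- `σₘ`, possibly the junk value `0` (then `ZMod k = ℤ`)
  set k : ℕ := sigmaGen g m h with hk_def
  have hbP : ∀ {a : HomotopySphereClass n}, a ∈ bP n →
      ∃ S : HomotopySphere n, mk S = a ∧ S.BoundsParallelizable := fun ha => ha
  -- the value `σ(M) mod σₘ` of a class in `bP`, through chosen representatives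
  let val : HomotopySphereClass n → ZMod k := fun a =>
    if ha : a ∈ bP n then
      (((hne (hbP ha).choose (hbP ha).choose_spec.2).some : ℤ) : ZMod k)
    else 0
  -- Thm. 7.5 (⇒): the value does not depend on the choices
  have hval : ∀ (S : HomotopySphere n) (σ : ℤ), σ ∈ signatureSet g m h S → mk S ∈ bP n →
      val (mk S) = (σ : ZMod k) := by
    intro S σ hσ ha
    simp only [val, dif_pos ha]
    have hS' := (hbP ha).choose_spec
    have hσ' := (hne (hbP ha).choose (hbP ha).choose_spec.2).some_mem
    have hdvd : (k : ℤ) ∣ _ - σ := (h75 _ S _ σ hσ' hσ).1 hS'.1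
    exact ((ZMod.intCast_eq_intCast_iff_dvd_sub σ _ k).2 hdvd).symm
  -- Thm. 7.5 (⇐): injectivity on `bP`
  have hinj : ∀ a ∈ bP n, ∀ b ∈ bP n, val a = val b → a = b := by
    rintro a ⟨S, rfl, hS⟩ b ⟨T, rfl, hT⟩ hab
    obtain ⟨σ, hσ⟩ := hne S hS
    obtain ⟨τ, hτ⟩ := hne T hT
    rw [hval S σ hσ (mk_mem_bP hS), hval T τ hτ (mk_mem_bP hT),
      ZMod.intCast_eq_intCast_iff_dvd_sub] at hab
    exact (h75 S T σ τ hσ hτ).2 ((dvd_sub_comm).1 hab)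
  -- §2: `val` is multiplicative on the subgroup `H ⊆ bP`
  have hmulH : ∀ a b : H,
      val ((a * b : H) : HomotopySphereClass n) = val (a : HomotopySphereClass n) + val b := by
    intro a b
    have ha : (a : HomotopySphereClass n) ∈ bP n := hH a.2
    have hb : (b : HomotopySphereClass n) ∈ bP n := hH b.2
    have hab : ((a * b : H) : HomotopySphereClass n) ∈ bP n := hH (a * b).2
    obtain ⟨c, hc⟩ := hmul a b
    have habc : (a : HomotopySphereClass n) * b = c := hcompat _ _ c hc
    obtain ⟨S, T, U, hS, hT, hU, hsum⟩ := hc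
    have haS : mk S ∈ bP n := by rw [hS]; exact ha
    have hbT : mk T ∈ bP n := by rw [hT]; exact hb
    have hcU : mk U ∈ bP n := by rw [hU, ← habc, ← Subgroup.coe_mul]; exact hab
    obtain ⟨σ, hσ⟩ := hne S (mk_mem_bP_iff.1 haS)
    obtain ⟨τ, hτ⟩ := hne T (mk_mem_bP_iff.1 hbT)
    have hστ : σ + τ ∈ signatureSet g m h U := hadd S T U hsum σ hσ τ hτ
    rw [Subgroup.coe_mul, habc, ← hU, hval U _ hστ hcU, ← hS, ← hT, hval S σ hσ haS,
      hval T τ hτ hbT, Int.cast_add]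
  have hval1 : val (1 : HomotopySphereClass n) = 0 := by
    have h11 := hmulH 1 1
    rw [mul_one, OneMemClass.coe_one] at h11
    simpa using h11
  -- the injective homomorphism `H → Multiplicative (ℤ/σₘ)`
  let φ : H →* Multiplicative (ZMod k) :=
    { toFun := fun x => Multiplicative.ofAdd (val x)
      map_one' := by simp [hval1]
      map_mul' := fun x y => by rw [← ofAdd_add, hmulH] }
  have hφ : Injective φ := fun x y hxy =>
    Subtype.ext (hinj x (hH x.2) y (hH y.2) (by simpa [φ] using hxy))
  -- a group embedding in the cyclic group `ℤ/σₘ` (any `σₘ`) is cyclic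
  exact isCyclic_of_surjective (MonoidHom.ofInjective hφ).symm
    (MonoidHom.ofInjective hφ).symm.surjective

/-- **Kervaire–Milnor Cor. 7.6 without "finite", in one dimension, from Thm. 7.5 (no Lemma 7.4).**
Let `n + 1 = 4m` and fix a commutative group structure on `Θₙ` whose multiplication is the connected
sum, whose unit is the class of the standard sphere (any orientation) and whose inverse is
`[Σ] ↦ [-Σ]` — as provided by Kervaire–Milnor's Thm. 1.1
(`Literature.Topology.FourManifolds.exists_commGroup_homotopySphereClass`) — and a generator convention `g`. Assume in this
dimension: Thm. 7.5, §2-additivity of `σ`, both Lemma 3.4 comparisons and the existence of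
products. Then `bPₙ₊₁ = bP n` is the carrier of a **cyclic** subgroup of `Θₙ`: it contains the unit
(`Sⁿ = b𝔻ⁿ⁺¹`, `HomotopySphereClass.one_mem_bP`), is closed under products (the boundary connected
sum of s-parallelizable manifolds, through §2-additivity and Lemma 3.4) and under inverses
(`-Σ = b(-W)`, `HomotopySphereClass.neg_mem_bP_iff`) — Kervaire–Milnor §4, p. 512: "these elements
form a group which we will denote by `bPₙ₊₁`" — and it embeds in `ℤ/σₘ`
(`isCyclic_of_coe_subset_bP`). Compared with `exists_subgroup_coe_eq_bP_of_dim`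
(`HomotopySpheresBPCyclic.lean`), Lemma 7.4 is traded for the unit and inverse laws and the
conclusion `Finite` is dropped. [cite: KervaireMilnorAnnals1963, Cor. 7.6 (p. 530, first sentence) with §4 (p. 512) and Thm. 1.1] -/
theorem exists_subgroup_coe_eq_bP_isCyclic_of_dim {m : ℕ} (h : n + 1 = 4 * m)
    [CommGroup (HomotopySphereClass n)]
    (hcompat : ∀ a b c : HomotopySphereClass n, IsMul a b c → a * b = c)
    (hone : ∀ o : SmoothOrientation (𝓡 n) (Metric.sphere (0 : EuclideanSpace ℝ (Fin (n + 1))) 1),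
      (mk ⟨Metric.sphere (0 : EuclideanSpace ℝ (Fin (n + 1))) 1, o, ⟨.refl _⟩⟩ :
        HomotopySphereClass n) = 1)
    (hinv : ∀ a : HomotopySphereClass n, a⁻¹ = a.neg)
    (g : Literature.AlgebraicTopology.SingularHomology.HomologicalOrientation ℤ (EuclideanSpace ℝ (Fin n)) n)
    (h75 : ∀ (S T : HomotopySphere n) (σ τ : ℤ), σ ∈ signatureSet g m h S →
      τ ∈ signatureSet g m h T → (mk S = mk T ↔ (sigmaGen g m h : ℤ) ∣ σ - τ))
    (hadd : ∀ S T U : HomotopySphere n,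
      IsOrientedConnectedSum S.orientation T.orientation U.orientation →
        ∀ σ ∈ signatureSet g m h S, ∀ τ ∈ signatureSet g m h T, σ + τ ∈ signatureSet g m h U)
    (hne : ∀ S : HomotopySphere n, S.BoundsParallelizable → (signatureSet g m h S).Nonempty)
    (hbd : ∀ (S : HomotopySphere n) (σ : ℤ), σ ∈ signatureSet g m h S → S.BoundsParallelizable)
    (hmul : ∀ a b : HomotopySphereClass n, ∃ c, IsMul a b c) :
    ∃ H : Subgroup (HomotopySphereClass n),
      (H : Set (HomotopySphereClass n)) = bP n ∧ IsCyclic H := by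
  -- §2 with Lemma 3.4: `bP` is closed under the product
  have hmulmem : ∀ a ∈ bP n, ∀ b ∈ bP n, a * b ∈ bP n := by
    intro a ha b hb
    obtain ⟨c, hc⟩ := hmul a b
    have habc : a * b = c := hcompat a b c hc
    obtain ⟨S, T, U, rfl, rfl, rfl, hsum⟩ := hc
    obtain ⟨σ, hσ⟩ := hne S (mk_mem_bP_iff.1 ha)
    obtain ⟨τ, hτ⟩ := hne T (mk_mem_bP_iff.1 hb)
    rw [habc]
    exact mk_mem_bP (hbd U _ (hadd S T U hsum σ hσ τ hτ))
  -- §4: `bP` as a subgroup (unit `Sⁿ = b𝔻ⁿ⁺¹`, inverses `-Σ = b(-W)`)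
  let H : Subgroup (HomotopySphereClass n) :=
    { carrier := bP n
      one_mem' := one_mem_bP hone
      mul_mem' := fun ha hb => hmulmem _ ha _ hb
      inv_mem' := fun {a} ha => by
        rw [hinv]
        exact (neg_mem_bP_iff a).2 ha }
  exact ⟨H, rfl, isCyclic_of_coe_subset_bP h hcompat g h75 hadd hne hmul H subset_rfl⟩

/-- **Cor. 7.6 without "finite", all `m > 1`, from four named facts and the laws of Thm. 1.1 (no
Lemma 7.4).** For `n + 1 = 4m`, `m > 1`, and any commutative group structure on `Θₙ` whose
multiplication is the connected sum, whose unit is `[Sⁿ]` and whose inverse is `[Σ] ↦ [-Σ]` (the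
shape provided by `Literature.Topology.FourManifolds.exists_commGroup_homotopySphereClass`, Kervaire–Milnor Thm. 1.1),
`bPₙ₊₁` is the carrier of a cyclic subgroup, given the named facts Thm. 7.5
(`mk_eq_mk_iff_sigmaGen_dvd_sub`), §2-additivity (`add_mem_signatureSet_of_isOrientedConnectedSum`)
and the two Lemma 3.4 comparisons (`nonempty_signatureSet_of_boundsParallelizable`,
`boundsParallelizable_of_mem_signatureSet`); products in `Θₙ`, `n ≥ 3`, exist unconditionally
(`isMul_exists_of_three_le`) and `ℝⁿ` is `ℤ`-orientable (`isOrientableOver_int_euclideanSpace`).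
Compare `isCyclic_bP_four_mul_of_signatureFacts` (`HomotopySpheresBPCyclic.lean`), which needs
Lemma 7.4 in addition and concludes finiteness as well. (`m > 1` enters only through Thm. 7.5.)
[cite: KervaireMilnorAnnals1963, Cor. 7.6 (p. 530, first sentence), Thm. 7.5, §2, Lemma 3.4, §4 (p. 512)] -/
theorem exists_subgroup_coe_eq_bP_isCyclic_of_signatureFacts
    (h75 : mk_eq_mk_iff_sigmaGen_dvd_sub)
    (hadd : add_mem_signatureSet_of_isOrientedConnectedSum)
    (hne : nonempty_signatureSet_of_boundsParallelizable)
    (hbd : boundsParallelizable_of_mem_signatureSet)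
    {m : ℕ} (hm : 1 < m) (h : n + 1 = 4 * m)
    [CommGroup (HomotopySphereClass n)]
    (hcompat : ∀ a b c : HomotopySphereClass n, IsMul a b c → a * b = c)
    (hone : ∀ o : SmoothOrientation (𝓡 n) (Metric.sphere (0 : EuclideanSpace ℝ (Fin (n + 1))) 1),
      (mk ⟨Metric.sphere (0 : EuclideanSpace ℝ (Fin (n + 1))) 1, o, ⟨.refl _⟩⟩ :
        HomotopySphereClass n) = 1)
    (hinv : ∀ a : HomotopySphereClass n, a⁻¹ = a.neg) :
    ∃ H : Subgroup (HomotopySphereClass n),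
      (H : Set (HomotopySphereClass n)) = bP n ∧ IsCyclic H := by
  -- a generator convention for `Hₙ(ℝⁿ | pt; ℤ)` (Hatcher Prop. 3.25 for the contractible `ℝⁿ`)
  obtain ⟨g⟩ := isOrientableOver_int_euclideanSpace n
  exact exists_subgroup_coe_eq_bP_isCyclic_of_dim h hcompat hone hinv g (h75 n m h hm g)
    (hadd n m h g) (hne n m h g) (hbd n m h g)
    (isMul_exists_of_three_le (n := n) (by omega) (by omega))

/-- **In dimension `7`, Lemma 7.4 is an instance of the attainment of `σ₂ = 224`.** The case
`n = 7`, `m = 2` of Kervaire–Milnor's Lemma 7.4 (`HomotopySphere.exists_mem_signatureSet_sphere_ne_zero`: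
some nonzero integer is `σ(M₀)` for an oriented s-parallelizable `M₀` bounded by `S⁷`) follows from
the named fact `HomotopySphere.exists_twoHundredTwentyFour_mem_signatureSet_sphere` (`224` is such a
signature; Kervaire–Milnor p. 530, `σₘ = 2²ᵐ⁻¹(2²ᵐ⁻¹ - 1)Bₘjₘaₘ/m`, so `σ₂ = 8 · 7 · 4 = 224`
with `B₂ = 1/30`, `j₂ = 240`, `a₂ = 1`; Kosinski IX.8.7), since
`224 ≠ 0`. [cite: KervaireMilnorAnnals1963, Lemma 7.4 (p. 529) and p. 530 (σ₂)] -/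
theorem _root_.Literature.Topology.FourManifolds.HomotopySphere.exists_mem_signatureSet_sphere_ne_zero_seven_of_twoHundredTwentyFour
    (h224 : exists_twoHundredTwentyFour_mem_signatureSet_sphere)
    (g : Literature.AlgebraicTopology.SingularHomology.HomologicalOrientation ℤ (EuclideanSpace ℝ (Fin 7)) 7)
    (h : 7 + 1 = 4 * 2) :
    ∃ (o : SmoothOrientation (𝓡 7) (Metric.sphere (0 : EuclideanSpace ℝ (Fin (7 + 1))) 1))
      (σ : ℤ), σ ∈ signatureSet g 2 h
        ⟨Metric.sphere (0 : EuclideanSpace ℝ (Fin (7 + 1))) 1, o, ⟨.refl _⟩⟩ ∧ σ ≠ 0 := by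
  obtain ⟨o, ho⟩ := h224 g h
  exact ⟨o, 224, ho, by norm_num⟩

/-- **`bP₈` is finite cyclic from `σ₂`-existence, Thm. 7.5, §2 and Lemma 3.4 (no separate
Lemma 7.4).** For an `IsMul`-compatible commutative group structure on `Θ₇` and a generator
convention `g`: if `224 ∈ σ(M₀)` for some oriented s-parallelizable `M₀` with `bM₀ = S⁷`
(`HomotopySphere.exists_twoHundredTwentyFour_mem_signatureSet_sphere`), and Thm. 7.5, §2-additivity
and both Lemma 3.4 comparisons hold at `n = 7`, `m = 2`, then `bP₈` is the carrier of a finite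
cyclic subgroup of `Θ₇` — `exists_subgroup_coe_eq_bP_of_dim` (`HomotopySpheresBPCyclic.lean`) with
its Lemma 7.4 input supplied by
`HomotopySphere.exists_mem_signatureSet_sphere_ne_zero_seven_of_twoHundredTwentyFour` and products
in `Θ₇` by `isMul_exists_of_three_le`. Kervaire–Milnor 1963, Cor. 7.6 at `m = 2`. [cite: KervaireMilnorAnnals1963, Cor. 7.6 (p. 530) at m = 2, with p. 530 (σ₂ = 224)] -/
theorem exists_subgroup_coe_eq_bP_seven_of_twoHundredTwentyFour
    [CommGroup (HomotopySphereClass 7)]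
    (hcompat : ∀ a b c : HomotopySphereClass 7, IsMul a b c → a * b = c)
    (g : Literature.AlgebraicTopology.SingularHomology.HomologicalOrientation ℤ (EuclideanSpace ℝ (Fin 7)) 7)
    (h : 7 + 1 = 4 * 2)
    (h224 : exists_twoHundredTwentyFour_mem_signatureSet_sphere)
    (h75 : ∀ (S T : HomotopySphere 7) (σ τ : ℤ), σ ∈ signatureSet g 2 h S →
      τ ∈ signatureSet g 2 h T → (mk S = mk T ↔ (sigmaGen g 2 h : ℤ) ∣ σ - τ))
    (hadd : ∀ S T U : HomotopySphere 7,
      IsOrientedConnectedSum S.orientation T.orientation U.orientation →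
        ∀ σ ∈ signatureSet g 2 h S, ∀ τ ∈ signatureSet g 2 h T, σ + τ ∈ signatureSet g 2 h U)
    (hne : ∀ S : HomotopySphere 7, S.BoundsParallelizable → (signatureSet g 2 h S).Nonempty)
    (hbd : ∀ (S : HomotopySphere 7) (σ : ℤ), σ ∈ signatureSet g 2 h S → S.BoundsParallelizable) :
    ∃ H : Subgroup (HomotopySphereClass 7),
      (H : Set (HomotopySphereClass 7)) = bP 7 ∧ IsCyclic H ∧ Finite H :=
  exists_subgroup_coe_eq_bP_of_dim h hcompat g
    (HomotopySphere.exists_mem_signatureSet_sphere_ne_zero_seven_of_twoHundredTwentyFour h224 g h)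
    h75 hadd hne hbd (isMul_exists_of_three_le (n := 7) (by norm_num) (by norm_num))

end HomotopySphereClass

/-! ### `Θ₇` is cyclic without Lemma 7.4 -/

/-- **`Θ₇` is cyclic from dimension-`7` inputs, without Lemma 7.4.** If `Θ₇` carries a commutative
group structure whose multiplication is the connected sum, every homotopy `7`-sphere bounds a
parallelizable manifold (`HomotopySphere.boundsParallelizable_seven`, Kervaire–Milnor §4 with the
table p. 512: `Θ₇ = bP₈`), and, for one generator convention `g` of `H₇(ℝ⁷ | pt; ℤ)`, Thm. 7.5,
the §2-additivity of `σ` and Lemma 3.4 (⇒) hold at `n = 7`, `m = 2`, then `Θ₇` is a cyclic group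
under connected sum (`Literature.Topology.FourManifolds.exists_commGroup_homotopySphereClass_isCyclic_seven`): the
whole group `Θ₇ = bP₈` embeds in `ℤ/σ₂` by `[bM] ↦ σ(M) mod σ₂`
(`HomotopySphereClass.isCyclic_of_coe_subset_bP` with `H = ⊤`; products in `Θ₇` exist
unconditionally, `HomotopySphereClass.isMul_exists_of_three_le`). Refines
`exists_commGroup_homotopySphereClass_isCyclic_seven_of_dim` (`HomotopySpheresBPCyclic.lean`): the
hypotheses Lemma 7.4 (`σ₂ ≠ 0`) and Lemma 3.4 (⇐) are gone. Kervaire–Milnor 1963, p. 512 and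
Cor. 7.6 (first sentence); Kosinski 1993, X §6: "`0 → bP⁸ → θ⁷ → Coker J₇ → 0` … Since
`Coker J₇ = 0`". [cite: KervaireMilnorAnnals1963, §4 p. 512 (table) and Cor. 7.6 (p. 530, first sentence) at m = 2] [cite: Kosinski1993, Ch. X §6, (6.6) and p. 218] -/
theorem exists_commGroup_homotopySphereClass_isCyclic_seven_of_dim_thm75
    (hA7 : ∃ _ : CommGroup (HomotopySphereClass 7),
      ∀ a b c : HomotopySphereClass 7, HomotopySphereClass.IsMul a b c → a * b = c)
    (hB : HomotopySphere.boundsParallelizable_seven)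
    (g : Literature.AlgebraicTopology.SingularHomology.HomologicalOrientation ℤ (EuclideanSpace ℝ (Fin 7)) 7)
    (h : 7 + 1 = 4 * 2)
    (h75 : ∀ (S T : HomotopySphere 7) (σ τ : ℤ), σ ∈ HomotopySphere.signatureSet g 2 h S →
      τ ∈ HomotopySphere.signatureSet g 2 h T →
        (HomotopySphereClass.mk S = HomotopySphereClass.mk T ↔
          (HomotopySphere.sigmaGen g 2 h : ℤ) ∣ σ - τ))
    (hadd : ∀ S T U : HomotopySphere 7,
      IsOrientedConnectedSum S.orientation T.orientation U.orientation →
        ∀ σ ∈ HomotopySphere.signatureSet g 2 h S, ∀ τ ∈ HomotopySphere.signatureSet g 2 h T,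
          σ + τ ∈ HomotopySphere.signatureSet g 2 h U)
    (hne : ∀ S : HomotopySphere 7, S.BoundsParallelizable →
      (HomotopySphere.signatureSet g 2 h S).Nonempty) :
    exists_commGroup_homotopySphereClass_isCyclic_seven := by
  obtain ⟨inst, hmul⟩ := hA7
  refine ⟨inst, hmul, ?_⟩
  -- (B): `bP₈ = Θ₇`, so the top subgroup lies in `bP₈`
  have htop : ((⊤ : Subgroup (HomotopySphereClass 7)) : Set (HomotopySphereClass 7)) ⊆
      HomotopySphereClass.bP 7 := by
    rw [HomotopySphereClass.bP_seven_eq_univ hB]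
    exact subset_univ _
  -- Cor. 7.6 (first sentence) at `m = 2`: `Θ₇ = bP₈ ↪ ℤ/σ₂` is cyclic
  haveI : IsCyclic (⊤ : Subgroup (HomotopySphereClass 7)) :=
    HomotopySphereClass.isCyclic_of_coe_subset_bP h hmul g h75 hadd hne
      (HomotopySphereClass.isMul_exists_of_three_le (n := 7) (by norm_num) (by norm_num)) ⊤ htop
  exact isCyclic_of_surjective (Subgroup.topEquiv : (⊤ : Subgroup (HomotopySphereClass 7)) ≃* _)
    Subgroup.topEquiv.surjective

/-- **`Θ₇` is cyclic from Thm. 1.1, `Θ₇ = bP₈`, Thm. 7.5, §2 and Lemma 3.4 — without Lemma 7.4.**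
The target `Literature.Topology.FourManifolds.exists_commGroup_homotopySphereClass_isCyclic_seven` from the named facts:
the group structure on `Θₙ` (Kervaire–Milnor Thm. 1.1, `exists_commGroup_homotopySphereClass`),
`Θ₇ = bP₈` (§4, `HomotopySphere.boundsParallelizable_seven`), Thm. 7.5 on classes
(`HomotopySphere.mk_eq_mk_iff_sigmaGen_dvd_sub`), the additivity of `σ` over connected sums
(§2, `HomotopySphere.add_mem_signatureSet_of_isOrientedConnectedSum`) and Lemma 3.4 (⇒)
(`HomotopySphere.nonempty_signatureSet_of_boundsParallelizable`); the generator convention is the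
theorem `isOrientableOver_int_euclideanSpace`. Compared with
`exists_commGroup_homotopySphereClass_isCyclic_seven_of''` (`HomotopySpheresBPProofs.lean`) and its
refinements, Lemma 7.4 (`HomotopySphere.exists_mem_signatureSet_sphere_ne_zero`) and Lemma 3.4 (⇐)
(`HomotopySphere.boundsParallelizable_of_mem_signatureSet`) are no longer hypotheses.
[cite: KervaireMilnorAnnals1963, Thm. 1.1, §4 (table p. 512), Thm. 7.5, Cor. 7.6 (p. 530, first sentence)] -/
theorem exists_commGroup_homotopySphereClass_isCyclic_seven_of_thm75
    (hA : exists_commGroup_homotopySphereClass)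
    (hB : HomotopySphere.boundsParallelizable_seven)
    (h75 : HomotopySphere.mk_eq_mk_iff_sigmaGen_dvd_sub)
    (hadd : HomotopySphere.add_mem_signatureSet_of_isOrientedConnectedSum)
    (hne : HomotopySphere.nonempty_signatureSet_of_boundsParallelizable) :
    exists_commGroup_homotopySphereClass_isCyclic_seven := by
  obtain ⟨inst, hmul, -, -⟩ := hA 7 (by norm_num) (by norm_num)
  -- a generator convention for `H₇(ℝ⁷ | pt; ℤ)` (Hatcher Prop. 3.25 for the contractible `ℝ⁷`)
  obtain ⟨g⟩ := isOrientableOver_int_euclideanSpace 7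
  have h : 7 + 1 = 4 * 2 := by norm_num
  exact exists_commGroup_homotopySphereClass_isCyclic_seven_of_dim_thm75 ⟨inst, hmul⟩ hB g h
    (h75 7 2 h (by norm_num) g) (hadd 7 2 h g) (hne 7 2 h g)

/-- **`Θ₇` is cyclic from thirteen named facts at the level of the printed statements — without
Lemma 7.4.** As `exists_commGroup_homotopySphereClass_isCyclic_seven_of_manifoldFacts`
(`HomotopySpheresBPProofs.lean`), whose fifteen leaves are: for Thm. 1.1 in dimension `7`, (iii) sums
of homotopy spheres are homotopy spheres (`HomotopySphere.nonempty_homotopyEquiv_sphere_of_isConnectedSum`,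
p. 505), (iv) Palais–Cerf uniqueness of oriented connected sums of homotopy `7`-spheres
(`exists_diffeomorph_isOrientationPreserving_of_isOrientedConnectedSum`, Lemma 2.1),
(v) associativity (`isOrientedConnectedSum_assoc`), (vii) `Σ # (-Σ) ∼ₕ Sⁿ`
(`HomotopySphere.isHCobordant_sphere_of_isOrientedConnectedSum_neg`, Lemmas 2.3–2.4), (viii) Smale's
h-cobordism theorem (`nonempty_diffeomorph_of_isHCobordant_of_five_le`); for Thm. 3.1 at `n = 7`,
`o₇` is the only obstruction (`HomotopySphere.hasStableTangentFramingAlong_compl_singleton`) and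
`π₆(SO(8)) = 0` (`Bott1959_sphereMapsToStableFramesExtend_six`); for §4 at `n = 7`, Lemma 3.3
(`exists_isNormalFraming_of_isStablyParallelizable`), Lemma 4.2
(`boundsParallelizable_of_collapseNullHomotopic`) and `0 ∈ p(Σ⁷)`
(`HomotopySphere.exists_collapseNullHomotopic_seven`); and for Cor. 7.6, Thm. 7.5
(`HomotopySphere.mk_eq_mk_iff_sigmaGen_dvd_sub`), §2-additivity of `σ`
(`HomotopySphere.add_mem_signatureSet_of_isOrientedConnectedSum`) and Lemma 3.4 (⇒)
(`HomotopySphere.nonempty_signatureSet_of_boundsParallelizable`) — but **not** Lemma 7.4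
(`HomotopySphere.exists_mem_signatureSet_sphere_ne_zero`) nor Lemma 3.4 (⇐)
(`HomotopySphere.boundsParallelizable_of_mem_signatureSet`): the group structure of Thm. 1.1
(`HomotopySphereClass.GroupLawFacts.exists_commGroup`, pure algebra, proved) is fed, together with
`Θ₇ = bP₈`, into `exists_commGroup_homotopySphereClass_isCyclic_seven_of_dim_thm75`.
[cite: KervaireMilnorAnnals1963, Thm. 1.1 (proof p. 507), §2 (pp. 505–507), Thm. 3.1 (p. 508), Lemma 3.3 (p. 509), §4 (pp. 510–512), Thm. 7.5, Cor. 7.6 (p. 530, first sentence)] [cite: Bott1959, Theorem (π₆(O) = 0)] -/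
theorem exists_commGroup_homotopySphereClass_isCyclic_seven_of_manifoldFacts_thm75
    (hK1 : HomotopySphere.nonempty_homotopyEquiv_sphere_of_isConnectedSum)
    (hPC : ∀ S T U U' : HomotopySphere 7,
      exists_diffeomorph_isOrientationPreserving_of_isOrientedConnectedSum (IM := 𝓡 7)
        (IN := 𝓡 7) (IP := 𝓡 7) (IP' := 𝓡 7) (M := S.carrier) (N := T.carrier)
        (P := U.carrier) (P' := U'.carrier))
    (hK2 : isOrientedConnectedSum_assoc.{0})
    (hK4 : HomotopySphere.isHCobordant_sphere_of_isOrientedConnectedSum_neg)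
    (hS15 : FourManifolds.nonempty_diffeomorph_of_isHCobordant_of_five_le.{0})
    (hAP : HomotopySphere.hasStableTangentFramingAlong_compl_singleton)
    (hBott : Bott1959_sphereMapsToStableFramesExtend_six)
    (h33 : exists_isNormalFraming_of_isStablyParallelizable)
    (h42 : boundsParallelizable_of_collapseNullHomotopic)
    (hc : HomotopySphere.exists_collapseNullHomotopic_seven)
    (h75 : HomotopySphere.mk_eq_mk_iff_sigmaGen_dvd_sub)
    (hadd : HomotopySphere.add_mem_signatureSet_of_isOrientedConnectedSum)
    (hne : HomotopySphere.nonempty_signatureSet_of_boundsParallelizable) :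
    exists_commGroup_homotopySphereClass_isCyclic_seven := by
  -- Thm. 1.1 in dimension 7: the group laws from the five remaining facts, then pure algebra
  have h7 : HomotopySphereClass.GroupLawFacts 7 :=
    HomotopySphereClass.groupLawFacts_of_remainingFacts (by norm_num) hK1 hPC hK2 hK4 hS15
  obtain ⟨o₀⟩ := (isOrientable_sphere_holds 7 : Nonempty _)
  obtain ⟨inst, hmul, -, -⟩ := h7.exists_commGroup o₀
  -- a generator convention for `H₇(ℝ⁷ | pt; ℤ)`
  obtain ⟨g⟩ := isOrientableOver_int_euclideanSpace 7
  have h : 7 + 1 = 4 * 2 := by norm_num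
  exact exists_commGroup_homotopySphereClass_isCyclic_seven_of_dim_thm75 ⟨inst, hmul⟩
    -- (B) `Θ₇ = bP₈`: Thm. 3.1 at `n = 7` by clutching, §4 at `n = 7` by Pontryagin–Thom
    (HomotopySphere.boundsParallelizable_seven_of' hBott hAP
      (HomotopySphere.boundsParallelizable_of_isStablyParallelizable_seven_of' h33 h42 hc))
    g h (h75 7 2 h (by norm_num) g) (hadd 7 2 h g) (hne 7 2 h g)

end Literature.Topology.FourManifolds
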